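import Mathlib
import Summits.PneNP.PneNP.Theorems.CnfIdealGenLengthRankDefectRepresentationsSimReduction
import Summits.PneNP.PneNP.Theorems.CnfIdealGenLengthRankDefectRepresentationsSimLowerBound

set_option linter.dupNamespace false

/-!
# One-sided SIM: gluing under a constant row colouring (`stub_oneSidedSim`)

Crux `stmt-PneNP-18923` (`Summit.PneNP.PneNP.Theses.CnfIdealGenLength.RankDefectRepresentations`), line
rank-dehn-ladder, RESHAPE 17 (brief g17 §W21): the TRUE calibration of the SUM currency for SIM
(`…SimReduction.SimBound`) in the one-sided situation of a CONSTANT row colouring `fun _ => r`.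

With a constant row colouring, `cut (fun _ => r) col k M` keeps exactly the columns `y'` with `r k ≠ col y' k`
(all rows).  The glued matrix is defined column by column by the SELECTION RULE: column `y'` of `z` is column
`y'` of `y k₀` for some (any) coordinate `k₀` with `r k₀ ≠ col y' k₀`, and `0` if there is none.  Then every
column of the error `cut k (z − y k)` is (minus) the corresponding column of one pairwise defect
`cut k (cut k₀ (y k − y k₀))`, so the column space of the error lies in the sum of the column spaces of the
defects `cut k (cut l (y k − y l))`, `l` ranging over the coordinates, and the rank bound
`rank (cut k (z − y k)) ≤ Σ_l rank (cut k (cut l (y k − y l)))` follows from monotonicity and subadditivity of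
`finrank`.  The support hypothesis `cut k (y k) = y k` of the registered signature is not needed.

FRONTIER formal rung; nothing here bears on P vs NP.
-/

namespace Summit.PneNP.PneNP.Theorems.CnfIdealGenLengthRankDefectRepresentationsOneSidedSim

open Matrix
open Summit.PneNP.PneNP.Theorems.CnfIdealGenLengthRankDefectRepresentationsSimReduction (cut)
open Summit.PneNP.PneNP.Theorems.CnfIdealGenLengthRankDefectRepresentationsSimLowerBound
  (col_mem_range finrank_sup_range_le)

variable {K : Type} [Field K]

/-- **One-sided gluing (general coordinate type).**  For a constant row colouring `fun _ => r` and ANY family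
`y : κ → Matrix ι ι' K` there is one matrix `z` (the selection-rule glue) with
`rank (cut k (z − y k)) ≤ Σ_l rank (cut k (cut l (y k − y l)))` for every coordinate `k`. -/
theorem oneSided_glue {κ ι ι' : Type} [Fintype κ] [DecidableEq κ] [Fintype ι] [Fintype ι'] [DecidableEq ι']
    (r : κ → Bool) (col : ι' → κ → Bool) (y : κ → Matrix ι ι' K) :
    ∃ z : Matrix ι ι' K, ∀ k,
      (cut (fun _ => r) col k (z - y k)).rank ≤
        ∑ l, (cut (fun _ => r) col k (cut (fun _ => r) col l (y k - y l))).rank := by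
  classical
  -- the selection-rule glue
  set z : Matrix ι ι' K :=
    Matrix.of fun x y' => if h : ∃ k, r k ≠ col y' k then y h.choose x y' else 0 with hz
  refine ⟨z, fun k => ?_⟩
  -- the pairwise defects seen from `k`
  set e : κ → Matrix ι ι' K :=
    fun l => cut (fun _ => r) col k (cut (fun _ => r) col l (y k - y l)) with he
  -- Step 1: every column of the error is (minus) a column of one defect, so the column space of the error
  -- lies in the sum of the column spaces of the defects.
  have hle : LinearMap.range (cut (fun _ => r) col k (z - y k)).mulVecLin ≤
      Finset.univ.sup fun l => LinearMap.range (e l).mulVecLin := by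
    rw [Matrix.range_mulVecLin, Submodule.span_le]
    rintro _ ⟨y', rfl⟩
    by_cases hk : r k = col y' k
    · -- column `y'` is killed by `cut k`
      have hcol : (cut (fun _ => r) col k (z - y k)).col y' = 0 := by
        funext x
        simp [Matrix.col_apply, cut, hk]
      rw [hcol]
      exact Submodule.zero_mem _
    · -- column `y'` survives `cut k`; `z` copied it from `y k₀` with `k₀ := h.choose`
      have h : ∃ k, r k ≠ col y' k := ⟨k, hk⟩
      have hk₀ : r h.choose ≠ col y' h.choose := h.choose_spec
      have hcol : (cut (fun _ => r) col k (z - y k)).col y' = -(fun x => e h.choose x y') := by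
        funext x
        simp [Matrix.col_apply, he, hz, cut, hk, hk₀, h]
      rw [hcol]
      exact Submodule.neg_mem _
        (Finset.le_sup (f := fun l => LinearMap.range (e l).mulVecLin) (Finset.mem_univ h.choose)
          (col_mem_range (e h.choose) y'))
  -- Step 2: dimensions.
  calc (cut (fun _ => r) col k (z - y k)).rank
      = Module.finrank K (LinearMap.range (cut (fun _ => r) col k (z - y k)).mulVecLin) := rfl
    _ ≤ Module.finrank K ↥(Finset.univ.sup fun l => LinearMap.range (e l).mulVecLin) :=
        Submodule.finrank_mono hle
    _ ≤ ∑ l ∈ Finset.univ, (e l).rank := finrank_sup_range_le e Finset.univ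
    _ = ∑ l, (cut (fun _ => r) col k (cut (fun _ => r) col l (y k - y l))).rank := rfl

/-- **`stub_oneSidedSim`** (registered stub of crux `stmt-PneNP-18923`, line rank-dehn-ladder, RESHAPE 17, brief g17 §W21):
one-sided SIM for a constant row colouring `r` on `Fin n` coordinates — the family `y` is glued by one matrix `z`
whose `k`-th error has rank at most the SUM of the ranks of the pairwise defects `cut k (cut l (y k − y l))`.
Immediate from `oneSided_glue` (the support hypothesis is not used). -/
theorem stub_oneSidedSim :
    ∀ (K : Type) [Field K] (n : ℕ) (ι ι' : Type) [Fintype ι] [Fintype ι'] [DecidableEq ι] [DecidableEq ι']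
      (r : Fin n → Bool) (col : ι' → Fin n → Bool) (y : Fin n → Matrix ι ι' K),
      (∀ k, Summit.PneNP.PneNP.Theorems.CnfIdealGenLengthRankDefectRepresentationsSimReduction.cut (fun _ => r) col k (y k) = y k) →
      ∃ z : Matrix ι ι' K, ∀ k,
        (Summit.PneNP.PneNP.Theorems.CnfIdealGenLengthRankDefectRepresentationsSimReduction.cut (fun _ => r) col k (z - y k)).rank ≤
          ∑ l, (Summit.PneNP.PneNP.Theorems.CnfIdealGenLengthRankDefectRepresentationsSimReduction.cut (fun _ => r) col k
            (Summit.PneNP.PneNP.Theorems.CnfIdealGenLengthRankDefectRepresentationsSimReduction.cut (fun _ => r) col l (y k - y l))).rank := by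
  intro K _ n ι ι' _ _ _ _ r col y _
  exact oneSided_glue r col y

end Summit.PneNP.PneNP.Theorems.CnfIdealGenLengthRankDefectRepresentationsOneSidedSim
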